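import Literature.AlgebraicGeometry.Resolution.FrobeniusClosedBases
import HarnessLib

/-!
# Dense lifted Frobenius-closed bases and congruence modulo `p`-th powers (Kuhlmann 2010, §4.2, Lemmas 4.7 / 4.11)

Topic: `Literature/AlgebraicGeometry/Resolution` (valued function fields). Vocabulary for the
Kummer normal form of F.-V. Kuhlmann, *Elimination of ramification I: The generalized stability
theorem*, Trans. AMS 362 (2010) 5697–5727 = arXiv:1003.5678, **Prop. 4.13** (the mixed
characteristic residue-transcendental case of Prop. 4.1 / Cor. 4.2: "In all cases, `[Ē:F̄] = p`"),
i.e. of the named fact `Kuhlmann2010Prop413ResidueDegree` (`NormalDegreePDefectlessGalois.lean`),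
the mixed characteristic leaf of the decomposition of `Kuhlmann2010Stability`
(`GeneralizedStabilityTrustBase.lean`). Prop. 4.13 runs in a subring `R ⊆ F` with a lifted
Frobenius-closed basis `𝓑`, whose existence in mixed characteristic is Lemma 4.11:

> **Lemma 4.7.** … Then `F` contains a subring `R` which satisfies: (LFC1) `R` contains `K` and
> its quotient field Quot(`R`) is dense in `F`, (LFC2) `R` admits a valuation basis
> `𝓑 = {uⱼ | j ∈ J}` over `K` of elements of value `0` and containing the element `1`, whose
> residues `ūⱼ`, `j ∈ J`, form a basis of `F̄|K̄`, (LFC3) `𝓑` is Frobenius-closed.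
>
> **Lemma 4.11.** In the case of `char K = 0` there exists a subfield `K₀` of `K` and a function
> field `F₀|K₀` … The field `F₀` contains a valuation independent set `𝓑` including `1` and
> closed under `p`-th powers such that `𝓑̄` is a Frobenius-closed basis of `F̄` over `K̄`. The
> ring `K₀[𝓑]` is dense in `F₀`, and the ring `R = K[𝓑]` satisfies properties (LFC1), (LFC2)
> and (LFC3).

In mixed characteristic the `K`-span of such a `𝓑` is NOT closed under multiplication (a product
`uᵢuⱼ` is a unit whose residue is a `K̄`-combination of the `ū_k`, but the lift differs from the
corresponding `K`-combination by an element of positive value), so `R = K[𝓑]` is not spanned by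
`𝓑`; what the proof of Prop. 4.13 uses of (LFC1)–(LFC3) is: the valuation independence of `𝓑`
over `K`, that the residues form a `K̄`-basis of `F̄`, Frobenius-closedness, the finiteness of the
`p`-height of every `u ≠ 1` in `𝓑` (proof of Prop. 4.12: "there exists an integer `ν = ν(uᵢ)`
such that `uᵢ ∉ F^{p^ν}`, and so `uᵢ ∉ 𝓑^{p^μ}`"), and the DENSITY of the `K`-linear combinations
of `𝓑` in `F` (through Lemma 4.9: "`u = 1 + ∑ cᵢuᵢ` with `cᵢ ∈ K`, `uᵢ ∈ 𝓑`"). This file records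
exactly that as a structure, the sibling of `IsLiftedFrobeniusClosedBasisRing`
(`FrobeniusClosedBases.lean`, the equal characteristic rendering with the ring `R = K[F̄]`, used by
Prop. 4.12), together with the congruence `x ≡ y mod (F^×)^p` of §4, (4.5) ("we can replace `a` by
any other element of `a(F^×)^p` without changing the extension `E|F`").

## Content

* `IsDenseLiftedFrobeniusClosedBasis V p K F B` — DEFINITION (structure, `Prop`-valued), with API:
  elements of `B` are units (`mem_valuationSubring`, `ne_zero`), residues are injective on `B`
  (`resid_injective`) and `p`-th roots in `B` are unique (`root_unique`); `K`-linear combinations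
  `f.sum (fun u c => c * u)` for `f : B →₀ K` (`lc_eq_sum`, `lc_add`, `lc_single`, `lc_smul`,
  `lc_mem`, `valuation_lc_le`); **valuation independence of `B` over `K`** derived from the linear
  independence of the residues (`valuation_coeff_le_valuation_lc`, `exists_valuation_lc_eq`,
  `valuation_lc_ne_zero`; Kuhlmann 2010, §2.4 / Lemma 4.11: "every such basis is a valuation
  basis"). PROVED.
* `ModPthPowers F p x y` — DEFINITION: `x = y·z^p` for some `z ∈ F^×`; an equivalence relation
  compatible with products (`refl`, `symm`, `trans`, `mul`, `mul_left`, `mul_right`, `prod`,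
  `pow_self`, `of_eq`). PROVED.

## Sources

* F.-V. Kuhlmann, *Elimination of ramification I: The generalized stability theorem*, Trans.
  Amer. Math. Soc. 362 (2010) 5697–5727 = arXiv:1003.5678: §2.4 (valuation independence), §4
  (4.5), §4.2 (Lemmas 4.7–4.11), §4.3 (Prop. 4.13 and its proof, p. 17 of the arXiv version).
  [Kuhlmann2010]

## Rendering notes

* Ambient rendering as in `FrobeniusClosedBases.lean`: one valued field `(Ω, V)`, subfields
  `K ≤ F ≤ Ω`, residues through `resid V`, residue fields `K̄ = residueSubfield K V ≤ F̄ =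
  residueSubfield F V ≤ Ωv`; "value `0`" is `V.valuation u = 1` (multiplicative notation).
* "Dense" is density for the valuation topology of `(F, v)`: every `a ∈ F` is approximated by a
  `K`-linear combination of `B` to within `v(ε)` for every `ε ∈ F^×` (the consequence of (LFC1)
  with Lemma 4.9 that §4.3 consumes). No subring `R` and no auxiliary `K₀ ⊆ K`, `F₀ ⊆ F` of
  Lemma 4.11 are part of the structure; they belong to the construction of an instance.
* Linear combinations are written with `Finsupp.sum` (as in `HenselizedRationalValues.lean`)
  rather than `Finsupp.linearCombination`, to keep the coercions `K → Ω`, `B → Ω` explicit.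
-/

noncomputable section

open IsLocalRing

namespace Literature.AlgebraicGeometry.Resolution

universe u

variable {Ω : Type u} [Field Ω] (V : ValuationSubring Ω)

/-! ### Dense lifted Frobenius-closed bases -/

/-- **A dense lifting `𝓑 ⊆ F` of a Frobenius-closed basis of `F̄|K̄`** (Kuhlmann 2010, §4.2,
Lemma 4.7 (LFC1)–(LFC3) in the form in which the Kummer normal form of Prop. 4.13 consumes them,
and Lemma 4.11: "The field `F₀` contains a valuation independent set `𝓑` including `1` and closed
under `p`-th powers such that `𝓑̄` is a Frobenius-closed basis of `F̄` over `K̄`. The ring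
`K₀[𝓑]` is dense in `F₀` …"): for subfields `K ≤ F` of the ambient valued field `(Ω, V)` and a
set `B ⊆ F` of elements of value `0` containing `1` and closed under `p`-th powers, the residues
`ū`, `u ∈ B`, form a `K̄`-basis of `F̄` (`K̄ = residueSubfield K V ≤ F̄ = residueSubfield F V`),
every `u ≠ 1` in `B` has finite `p`-height in `B` (Kuhlmann 2010, proof of Prop. 4.12: "there
exists an integer `ν = ν(uᵢ)` such that `uᵢ ∉ F^{p^ν}`, and so `uᵢ ∉ 𝓑^{p^ν}`"), and the
`K`-linear combinations of `B` are DENSE in `F` (the part of (LFC1) "Quot(`R`) is dense in `F`"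
that §4.3 uses, through Lemma 4.9: every element of `F` is approximated by `K`-linear
combinations of `𝓑`). Compared with `IsLiftedFrobeniusClosedBasisRing` (`FrobeniusClosedBases.lean`,
the equal characteristic rendering, where `R = K[F̄]` is the `K`-span of `𝓑` and a ring), no
subring is recorded: in mixed characteristic the `K`-span of a lifted basis is not closed under
multiplication, and only its density is used. (Valuation independence of `B` over `K` follows
from the linear independence of the residues: `valuation_coeff_le_valuation_lc`.)
[cite: Kuhlmann2010, Lemma 4.7 ((LFC1)–(LFC3)), Lemma 4.11 and Section 4.3] -/
structure IsDenseLiftedFrobeniusClosedBasis (p : ℕ) (K F : Subfield Ω) (B : Set Ω) : Prop where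
  /-- `K ≤ F`. -/
  le : K ≤ F
  /-- `B ⊆ F`. -/
  subset : B ⊆ F
  /-- `1 ∈ B`. -/
  one_mem : (1 : Ω) ∈ B
  /-- the elements of `B` have value `0` (multiplicatively: `1`). -/
  valuation_eq_one : ∀ u ∈ B, V.valuation u = 1
  /-- `B` is closed under `p`-th powers ("Frobenius-closed"). -/
  pow_mem : ∀ u ∈ B, u ^ p ∈ B
  /-- the residues of the elements of `B` are `K̄`-linearly independent … -/
  resid_linearIndependent :
    LinearIndependent (residueSubfield K V) (fun u : B => resid V (u : Ω))
  /-- … and span `F̄` over `K̄`. -/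
  resid_span : ∀ r ∈ residueSubfield F V,
    r ∈ Submodule.span (residueSubfield K V) (Set.range fun u : B => resid V (u : Ω))
  /-- every `u ≠ 1` in `B` has finite `p`-height in `B`. -/
  finite_height : ∀ u ∈ B, u ≠ 1 → ∃ n : ℕ, ∀ w ∈ B, w ^ p ^ n ≠ u
  /-- the `K`-linear combinations of `B` are dense in `F`. -/
  dense : ∀ a ∈ F, ∀ ε ∈ F, ε ≠ 0 →
    ∃ f : B →₀ K, V.valuation (a - f.sum fun u c => (c : Ω) * (u : Ω)) < V.valuation ε

namespace IsDenseLiftedFrobeniusClosedBasis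

variable {V} {p : ℕ} {K F : Subfield Ω} {B : Set Ω}
variable (h : IsDenseLiftedFrobeniusClosedBasis V p K F B)
include h

/-- Elements of `B` lie in `V`. [folklore] -/
theorem mem_valuationSubring {u : Ω} (hu : u ∈ B) : u ∈ V :=
  (V.valuation_le_one_iff u).mp (h.valuation_eq_one u hu).le

/-- Elements of `B` are non-zero. [folklore] -/
theorem ne_zero {u : Ω} (hu : u ∈ B) : u ≠ 0 := by
  intro h0
  have := h.valuation_eq_one u hu
  rw [h0, map_zero] at this
  exact zero_ne_one this

/-- Distinct elements of `B` have distinct residues. [folklore] -/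
theorem resid_injective {u w : Ω} (hu : u ∈ B) (hw : w ∈ B) (huw : resid V u = resid V w) :
    u = w := by
  have hinj := h.resid_linearIndependent.injective
  have := @hinj ⟨u, hu⟩ ⟨w, hw⟩ huw
  exact congrArg Subtype.val this

/-- `p`-th roots inside `B` are unique (when `char Ωv = p`). [folklore] -/
theorem root_unique [hp : Fact p.Prime] [CharP (ResidueField V) p] {u w w' : Ω} (hw : w ∈ B)
    (hw' : w' ∈ B) (hwu : w ^ p = u) (hw'u : w' ^ p = u) : w = w' := by
  refine h.resid_injective hw hw' (frobenius_inj (ResidueField V) p ?_)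
  rw [frobenius_def, frobenius_def, ← resid_pow V (h.mem_valuationSubring hw),
    ← resid_pow V (h.mem_valuationSubring hw'), hwu, hw'u]

omit h in
/-- A `K`-linear combination of `B`, written as a sum over the support. [folklore] -/
theorem lc_eq_sum (f : B →₀ K) :
    (f.sum fun u c => (c : Ω) * (u : Ω)) = ∑ u ∈ f.support, (f u : Ω) * (u : Ω) := rfl

omit h in
/-- Additivity of linear combinations. [folklore] -/
theorem lc_add (f g : B →₀ K) :
    ((f + g).sum fun u c => (c : Ω) * (u : Ω)) =
      (f.sum fun u c => (c : Ω) * (u : Ω)) + g.sum fun u c => (c : Ω) * (u : Ω) := by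
  refine Finsupp.sum_add_index' (fun u => ?_) (fun u b₁ b₂ => ?_)
  · rw [ZeroMemClass.coe_zero]
    exact zero_mul _
  · rw [Subfield.coe_add]
    exact add_mul _ _ _

omit h in
/-- The linear combination of a single term. [folklore] -/
theorem lc_single (u : B) (c : K) :
    ((Finsupp.single u c).sum fun u c => (c : Ω) * (u : Ω)) = (c : Ω) * (u : Ω) := by
  rw [Finsupp.sum_single_index]
  rw [ZeroMemClass.coe_zero]
  exact zero_mul _

omit h in
/-- Scaling a linear combination by a constant of `K`. [folklore] -/
theorem lc_smul (a : K) (f : B →₀ K) :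
    ((a • f).sum fun u c => (c : Ω) * (u : Ω)) = (a : Ω) * f.sum fun u c => (c : Ω) * (u : Ω) := by
  rw [Finsupp.sum_smul_index' (fun u => by rw [ZeroMemClass.coe_zero]; exact zero_mul _),
    Finsupp.sum, Finsupp.sum, Finset.mul_sum]
  refine Finset.sum_congr rfl fun u _ => ?_
  rw [smul_eq_mul, Subfield.coe_mul, mul_assoc]

/-- `K`-linear combinations of `B` lie in `F`. [folklore] -/
theorem lc_mem (f : B →₀ K) : (f.sum fun u c => (c : Ω) * (u : Ω)) ∈ F :=
  sum_mem fun u _ => mul_mem (h.le (f u).2) (h.subset u.2)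

/-- The value of a linear combination is at most the largest value of a coefficient
(ultrametric inequality; the `u ∈ B` are units). [folklore] -/
theorem valuation_lc_le {f : B →₀ K} {γ : V.ValueGroup} (hf : ∀ u ∈ f.support, V.valuation (f u : Ω) ≤ γ) :
    V.valuation (f.sum fun u c => (c : Ω) * (u : Ω)) ≤ γ := by
  rw [lc_eq_sum]
  refine Valuation.map_sum_le _ fun u hu => ?_
  rw [map_mul, h.valuation_eq_one u u.2, mul_one]
  exact hf u hu

/-- **Valuation independence of `B` over `K`** (Kuhlmann 2010, §2.4: "`v ∑ cᵢbᵢ = min vcᵢbᵢ`";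
Lemma 4.11: "every such basis is a valuation basis", because the residues are linearly
independent): every coefficient of a `K`-linear combination of `B` has value at most the value
of the combination. PROVED: at a coefficient `c₀` of maximal value, the combination divided by
`c₀` has unit coefficients with residues not all zero, so its residue — the corresponding
combination of the linearly independent residues — is non-zero. [cite: Kuhlmann2010, Section 2.4 and Lemma 4.11] -/
theorem valuation_coeff_le_valuation_lc (f : B →₀ K) (u : B) :
    V.valuation (f u : Ω) ≤ V.valuation (f.sum fun u c => (c : Ω) * (u : Ω)) := by
  classical
  by_cases hf : f = 0
  · simp [hf]
  -- a coefficient of maximal value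
  obtain ⟨u₀, hu₀, hmax⟩ := Finset.exists_max_image f.support (fun w => V.valuation (f w : Ω))
    (Finsupp.support_nonempty_iff.mpr hf)
  have hc₀ : (f u₀ : Ω) ≠ 0 := fun h0 => (Finsupp.mem_support_iff.mp hu₀) (Subtype.ext h0)
  -- it suffices to treat `u = u₀`
  suffices key : V.valuation (f u₀ : Ω) ≤ V.valuation (f.sum fun u c => (c : Ω) * (u : Ω)) by
    by_cases hu : u ∈ f.support
    · exact (hmax u hu).trans key
    · rw [Finsupp.notMem_support_iff.mp hu, ZeroMemClass.coe_zero, map_zero]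
      exact zero_le
  -- normalise: `g = c₀⁻¹ f` has coefficients of value `≤ 1` and `g u₀ = 1`
  set g : B →₀ K := (f u₀)⁻¹ • f with hg
  have hgu : ∀ w, (g w : Ω) = (f u₀ : Ω)⁻¹ * (f w : Ω) := fun w => by
    rw [hg, Finsupp.smul_apply, smul_eq_mul, Subfield.coe_mul, Subfield.coe_inv]
  have hgval : ∀ w, V.valuation (g w : Ω) ≤ 1 := by
    intro w
    rw [hgu, map_mul, map_inv₀]
    by_cases hw : w ∈ f.support
    · rw [inv_mul_le_iff₀ ((Valuation.pos_iff _).mpr hc₀), mul_one]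
      exact hmax w hw
    · rw [Finsupp.notMem_support_iff.mp hw, ZeroMemClass.coe_zero, map_zero, mul_zero]
      exact zero_le
  have hgu₀ : (g u₀ : Ω) = 1 := by rw [hgu, inv_mul_cancel₀ hc₀]
  have hgmem : ∀ w, (g w : Ω) ∈ V := fun w => (V.valuation_le_one_iff _).mp (hgval w)
  -- the combination `lc g` lies in `V`; its residue is `∑ ḡ_w w̄ ≠ 0`
  have hlcg : (g.sum fun u c => (c : Ω) * (u : Ω)) = (f u₀ : Ω)⁻¹ * f.sum fun u c => (c : Ω) * (u : Ω) := by
    rw [hg, lc_smul, Subfield.coe_inv]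
  have hlcgV : (g.sum fun u c => (c : Ω) * (u : Ω)) ∈ V := by
    rw [← V.valuation_le_one_iff]
    exact h.valuation_lc_le fun w _ => hgval w
  -- suppose the value of `lc g` were `< 1`
  by_contra hlt
  push Not at hlt
  have hlt' : V.valuation (g.sum fun u c => (c : Ω) * (u : Ω)) < 1 := by
    rw [hlcg, map_mul, map_inv₀, inv_mul_lt_iff₀ ((Valuation.pos_iff _).mpr hc₀), mul_one]
    exact hlt
  have hres0 : resid V (g.sum fun u c => (c : Ω) * (u : Ω)) = 0 :=
    (resid_eq_zero_iff V hlcgV).mpr hlt'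
  -- the residue is the `K̄`-combination of the residues
  have hres : resid V (g.sum fun u c => (c : Ω) * (u : Ω)) =
      ∑ w ∈ g.support, (⟨resid V (g w : Ω), resid_mem_residueSubfield V (g w).2⟩ :
        residueSubfield K V) • resid V (w : Ω) := by
    rw [lc_eq_sum, resid_sum V _ _ fun w _ => mul_mem (hgmem w) (h.mem_valuationSubring w.2)]
    refine Finset.sum_congr rfl fun w _ => ?_
    rw [resid_mul V (hgmem w) (h.mem_valuationSubring w.2), Algebra.smul_def]
    rfl
  rw [hres] at hres0
  have hli := linearIndependent_iff'.mp h.resid_linearIndependent g.support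
    (fun w => ⟨resid V (g w : Ω), resid_mem_residueSubfield V (g w).2⟩) hres0 u₀
    (by rw [hg, Finsupp.support_smul_eq (inv_ne_zero fun h0 => hc₀ (by rw [h0]; rfl))]; exact hu₀)
  have : resid V (g u₀ : Ω) = 0 := congrArg Subtype.val hli
  rw [hgu₀, resid_one] at this
  exact one_ne_zero this

/-- The `max` form of valuation independence: a non-zero combination has the value of one of its
coefficients, which dominates all the others. [folklore] -/
theorem exists_valuation_lc_eq (f : B →₀ K) (hf : f ≠ 0) :
    ∃ u ∈ f.support, V.valuation (f.sum fun u c => (c : Ω) * (u : Ω)) = V.valuation (f u : Ω) ∧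
      ∀ w, V.valuation (f w : Ω) ≤ V.valuation (f u : Ω) := by
  classical
  obtain ⟨u₀, hu₀, hmax⟩ := Finset.exists_max_image f.support (fun w => V.valuation (f w : Ω))
    (Finsupp.support_nonempty_iff.mpr hf)
  have hmax' : ∀ w, V.valuation (f w : Ω) ≤ V.valuation (f u₀ : Ω) := by
    intro w
    by_cases hw : w ∈ f.support
    · exact hmax w hw
    · rw [Finsupp.notMem_support_iff.mp hw, ZeroMemClass.coe_zero, map_zero]
      exact zero_le
  exact ⟨u₀, hu₀, le_antisymm (h.valuation_lc_le fun w _ => hmax' w)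
    (h.valuation_coeff_le_valuation_lc f u₀), hmax'⟩

/-- A non-zero combination is non-zero and its value is non-zero. [folklore] -/
theorem valuation_lc_ne_zero (f : B →₀ K) (hf : f ≠ 0) :
    V.valuation (f.sum fun u c => (c : Ω) * (u : Ω)) ≠ 0 := by
  obtain ⟨u, hu, heq, -⟩ := h.exists_valuation_lc_eq f hf
  rw [heq, map_ne_zero]
  exact fun h0 => (Finsupp.mem_support_iff.mp hu) (Subtype.ext h0)

end IsDenseLiftedFrobeniusClosedBasis

/-! ### Congruence modulo `p`-th powers of `F^×` -/

section ModPow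

variable {V}

/-- **`x ≡ y` modulo `(F^×)^p`**: `x = y·z^p` for some `z ∈ F^×` (Kuhlmann 2010, §4, (4.5):
"we can replace `a` by any other element of `a (F^×)^p` without changing the extension").
[cite: Kuhlmann2010, Section 4, (4.5)] -/
def ModPthPowers (F : Subfield Ω) (p : ℕ) (x y : Ω) : Prop :=
  ∃ z ∈ F, z ≠ 0 ∧ x = y * z ^ p

variable {F : Subfield Ω} {p : ℕ}

/-- Reflexivity of `≡ mod (F^×)^p`. [folklore] -/
theorem ModPthPowers.refl (x : Ω) : ModPthPowers F p x x :=
  ⟨1, F.one_mem, one_ne_zero, by rw [one_pow, mul_one]⟩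

/-- Symmetry of `≡ mod (F^×)^p`. [folklore] -/
theorem ModPthPowers.symm {x y : Ω} (h : ModPthPowers F p x y) : ModPthPowers F p y x := by
  obtain ⟨z, hzF, hz0, rfl⟩ := h
  refine ⟨z⁻¹, F.inv_mem hzF, inv_ne_zero hz0, ?_⟩
  rw [inv_pow, mul_assoc, mul_inv_cancel₀ (pow_ne_zero _ hz0), mul_one]

/-- Transitivity of `≡ mod (F^×)^p`. [folklore] -/
theorem ModPthPowers.trans {x y z : Ω} (h₁ : ModPthPowers F p x y) (h₂ : ModPthPowers F p y z) :
    ModPthPowers F p x z := by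
  obtain ⟨a, haF, ha0, rfl⟩ := h₁
  obtain ⟨b, hbF, hb0, rfl⟩ := h₂
  exact ⟨b * a, mul_mem hbF haF, mul_ne_zero hb0 ha0, by rw [mul_pow, mul_assoc]⟩

/-- `≡ mod (F^×)^p` is compatible with products. [folklore] -/
theorem ModPthPowers.mul {x y x' y' : Ω} (h₁ : ModPthPowers F p x y) (h₂ : ModPthPowers F p x' y') :
    ModPthPowers F p (x * x') (y * y') := by
  obtain ⟨a, haF, ha0, rfl⟩ := h₁
  obtain ⟨b, hbF, hb0, rfl⟩ := h₂
  exact ⟨a * b, mul_mem haF hbF, mul_ne_zero ha0 hb0, by rw [mul_pow]; ring⟩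

/-- `≡ mod (F^×)^p` is compatible with right multiplication. [folklore] -/
theorem ModPthPowers.mul_right {x y : Ω} (h : ModPthPowers F p x y) (c : Ω) :
    ModPthPowers F p (x * c) (y * c) :=
  h.mul (ModPthPowers.refl c)

/-- `≡ mod (F^×)^p` is compatible with left multiplication. [folklore] -/
theorem ModPthPowers.mul_left {x y : Ω} (h : ModPthPowers F p x y) (c : Ω) :
    ModPthPowers F p (c * x) (c * y) :=
  (ModPthPowers.refl c).mul h

/-- A `p`-th power of an element of `F^×` is `≡ 1`. [folklore] -/
theorem ModPthPowers.pow_self {z : Ω} (hzF : z ∈ F) (hz0 : z ≠ 0) : ModPthPowers F p (z ^ p) 1 :=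
  ⟨z, hzF, hz0, by rw [one_mul]⟩

/-- Equal elements are `≡ mod (F^×)^p`. [folklore] -/
theorem ModPthPowers.of_eq {x y : Ω} (h : x = y) : ModPthPowers F p x y := h ▸ ModPthPowers.refl x

/-- A finite product of congruences. [folklore] -/
theorem ModPthPowers.prod {ι : Type*} (s : Finset ι) {x y : ι → Ω}
    (h : ∀ i ∈ s, ModPthPowers F p (x i) (y i)) :
    ModPthPowers F p (∏ i ∈ s, x i) (∏ i ∈ s, y i) := by
  classical
  induction s using Finset.induction_on with
  | empty => simpa using ModPthPowers.refl (F := F) (p := p) (1 : Ω)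
  | insert i s hi ih =>
    rw [Finset.prod_insert hi, Finset.prod_insert hi]
    exact (h i (Finset.mem_insert_self i s)).mul (ih fun j hj => h j (Finset.mem_insert_of_mem hj))

end ModPow

end Literature.AlgebraicGeometry.Resolution
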